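import Literature.NumberTheory.GaloisRepresentations.LubinTateRelativeTowerCharacterCells
import Literature.NumberTheory.GaloisRepresentations.LubinTateUnramifiedDisjoint
import HarnessLib

/-!
# The relative Lubin–Tate tower over an UNRAMIFIED base `E ⊆ F^{nr}`: the surjectivity input `hκ`
# is unconditional (de Shalit 1987, I.1.8: `Gal(k'(W_f^{n+1})/k') ≅ (𝒪_k/𝔭^{n+1})ˣ` for `k'/k` unramified)

`LubinTateRelativeTowerCharacterCells.lean` built, for a finite subextension `E ⊆ F̄` of a local field
`F`, the tower `ltRelTower hπ E` of `Γ_E = Gal(F̄/E)` (`U_n = Γ_E ∩ Gal(F̄/K_π^{n+1})`), the `hU` input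
`mem_ltRelTower_iff` of the character cell maps for `κ_E = (e ∘ χ_π)|_{Γ_E}`, and the `hκ` input
`exists_toZModPow_ltRelCharacter_eq` UNDER the disjointness hypothesis `E ⊓ ltField π n = ⊥`.
`LubinTateUnramifiedDisjoint.lean` (the units lane) proves the disjointness in Galois form for
`E ≤ maxUnramified F`: `exists_absGal_fixing_ltAbsChar_eq` — the level-`(n+1)` Lubin–Tate character is
still ONTO on `Gal(F̄/E)` — and `forall_mem_sup_ltField_smul_eq_iff_ltAbsChar_eq_one` — its kernel there
is `Gal(F̄/E·K_π^{n+1})`. This file plugs the two together: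

* `mem_fixingSubgroup_comap_iff_forall_smul` — `σ ∈ Γ_E ↔ σ` fixes `E` pointwise (dictionary);
* `mem_ltRelTower_U_iff_forall_smul` — **`U_n = Gal(F̄/E·K_π^{n+1})`**: `σ ∈ U_n ↔ σ` fixes `E ⊔ K_π^{n+1}`;
* ★ **`exists_toZModPow_ltRelCharacter_eq_of_le_maxUnramified`** — `hκ` for `(ltRelTower hπ E, κ_E)`
  with NO disjointness hypothesis when `E ≤ maxUnramified F`;
* `integral_comap_restrictUnits_ltRelTower_of_le_maxUnramified` — de Shalit's (10) on `Γ_E`, `p = 2`,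
  unconditional for unramified `E` (`GroupDistribution.integral_comap_restrictUnits_of_character_two`).

Theorems only; no definitions, no named facts, no instances, no `sorry`.

## References

* [deShalit1987] E. de Shalit, *Iwasawa theory of elliptic curves with complex multiplication* (1987),
  I.1.1, I.1.8 (p. 9, 13), I.3.3 (9), I.3.4 (10) (p. 17–18).
* [CasselsFrohlichANT1967] J.-P. Serre, *Local class field theory*, Ch. VI of Cassels–Fröhlich (1967),
  §3.6 Prop. 6 (b).
-/

noncomputable section

open scoped Classical

namespace Literature.NumberTheory.GaloisRepresentations

section Unramified

open ValuativeRel GaloisRepresentations.IsNonarchimedeanLocalField LubinTate Field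
open Literature.NumberTheory.EllipticCurves

variable {F : Type*} [Field F] [ValuativeRel F] [TopologicalSpace F] [IsNonarchimedeanLocalField F]
variable {π : 𝒪[F]} (hπ : (valuation F).IsUniformizer (π : F))
variable (E : IntermediateField F (AlgebraicClosure F))

omit [ValuativeRel F] [TopologicalSpace F] [IsNonarchimedeanLocalField F] in
/-- Dictionary: `σ ∈ Γ_E` (the pull-back of `E.fixingSubgroup` to `Γ_F`) iff `σ` fixes `E` pointwise.
[cite: deShalit1987, I.1.1 (p. 9)] -/
theorem mem_fixingSubgroup_comap_iff_forall_smul (σ : Field.absoluteGaloisGroup F) :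
    σ ∈ E.fixingSubgroup.comap (Field.absoluteGaloisGroup.toAlgEquiv F).toMonoidHom ↔
      ∀ x : E, σ • (x : AlgebraicClosure F) = x := by
  rw [Subgroup.mem_comap, MulEquiv.toMonoidHom_eq_coe, MonoidHom.coe_coe,
    IntermediateField.mem_fixingSubgroup_iff]
  refine ⟨fun h x ↦ ?_, fun h x hx ↦ ?_⟩
  · rw [absoluteGaloisGroup.smul_def]
    exact h x x.2
  · have := h ⟨x, hx⟩
    rwa [absoluteGaloisGroup.smul_def] at this

/-- **`U_n = Gal(F̄/E·K_π^{n+1})`**: an element of `Γ_E` lies in the level `U_n` of the relative tower iff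
it fixes the compositum `E ⊔ K_π^{n+1}` pointwise (the units lane's
`forall_mem_sup_ltField_smul_eq_iff_ltAbsChar_eq_one`). [cite: deShalit1987, I.1.8 (p. 13)]
[cite: CasselsFrohlichANT1967, Ch. VI §3.6 Prop. 6 (b)] -/
theorem mem_ltRelTower_U_iff_forall_smul (n : ℕ)
    (σ : ↥(E.fixingSubgroup.comap (Field.absoluteGaloisGroup.toAlgEquiv F).toMonoidHom)) :
    σ ∈ (ltRelTower hπ E).U n ↔
      ∀ z ∈ (E ⊔ ltField π n : IntermediateField F (AlgebraicClosure F)),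
        (σ : Field.absoluteGaloisGroup F) • z = z := by
  rw [mem_ltRelTower_U_iff, ltTower_U, MonoidHom.mem_ker,
    ← forall_mem_sup_ltField_smul_eq_iff_ltAbsChar_eq_one hπ E n
      ((mem_fixingSubgroup_comap_iff_forall_smul E _).mp σ.2)]

variable {p : ℕ} [Fact p.Prime] (e : 𝒪[F] ≃+* ℤ_[p])

/-- ★ **`hκ` for the relative Lubin–Tate tower over an unramified base, unconditionally**: for
`E ≤ maxUnramified F` finite over `F`, every `u ∈ ℤ_pˣ` with `u ≡ 1 mod p` is `≡ κ_E(σ) mod p^{n+1}`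
for some `σ ∈ Γ_E` in `U_0` — the hypothesis `hκ` of `SubgroupTower.cellMap_fiberSurj` /
`exists_cell_cellMap_eq` for `(ltRelTower hπ E, κ_E)`, VERBATIM, from the units lane's
`exists_absGal_fixing_ltAbsChar_eq` (the level-`(n+1)` character is onto on `Gal(F̄/E)`).
[cite: deShalit1987, I.1.8 (p. 13), I.3.3 (9) (p. 18)] [cite: CasselsFrohlichANT1967, Ch. VI §3.6 Prop. 6 (b)] -/
theorem exists_toZModPow_ltRelCharacter_eq_of_le_maxUnramified [FiniteDimensional F E]
    (hE : E ≤ maxUnramified F) (n : ℕ) (u : ℤ_[p]ˣ) (hu : PadicInt.toZModPow 1 (u : ℤ_[p]) = 1) :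
    ∃ σ ∈ (ltRelTower hπ E).U 0,
      PadicInt.toZModPow (n + 1)
        ((((Units.map (e : 𝒪[F] →+* ℤ_[p]).toMonoidHom).comp (lubinTateCharHom hπ)).comp
          (E.fixingSubgroup.comap (Field.absoluteGaloisGroup.toAlgEquiv F).toMonoidHom).subtype σ :
            ℤ_[p]ˣ) : ℤ_[p]) =
        PadicInt.toZModPow (n + 1) (u : ℤ_[p]) := by
  -- the unit `v = e⁻¹ u` of `𝒪_F` and a `σ ∈ Γ_E` with `ltAbsChar n σ = v mod π^{n+1}`
  set v : 𝒪[F]ˣ := Units.map (e.symm : ℤ_[p] →+* 𝒪[F]).toMonoidHom u with hv_def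
  have hv : e (v : 𝒪[F]) = u := by
    rw [hv_def, Units.coe_map, RingHom.toMonoidHom_eq_coe, MonoidHom.coe_coe, RingHom.coe_coe,
      RingEquiv.apply_symm_apply]
  obtain ⟨σ, hσE, hσ⟩ := exists_absGal_fixing_ltAbsChar_eq hπ E hE n v
  have hσ' : ltAbsChar hπ n σ = unitsModPow π n v := Units.ext hσ
  have hσmem : σ ∈ E.fixingSubgroup.comap (Field.absoluteGaloisGroup.toAlgEquiv F).toMonoidHom :=
    (mem_fixingSubgroup_comap_iff_forall_smul E σ).mpr hσE
  have hσn : PadicInt.toZModPow (n + 1)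
      (((Units.map (e : 𝒪[F] →+* ℤ_[p]).toMonoidHom).comp (lubinTateCharHom hπ) σ : ℤ_[p]ˣ) : ℤ_[p]) =
        PadicInt.toZModPow (n + 1) (u : ℤ_[p]) := by
    rw [coe_ltCharacter_apply, ← hv, ← unitsModPow_eq_iff_toZModPow_map_eq hπ e,
      unitsModPow_lubinTateChar, hσ']
  refine ⟨⟨σ, hσmem⟩, ?_, hσn⟩
  -- `σ ∈ U_0` because `κ(σ) ≡ u ≡ 1 mod p`
  have hp : p.Prime := Fact.out
  haveI : NeZero (p ^ (n + 1)) := ⟨pow_ne_zero _ hp.ne_zero⟩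
  rw [mem_ltRelTower_U_iff, mem_ltTower_U_iff_toZModPow hπ e 0]
  change PadicInt.toZModPow 1 _ = 1
  rw [← PadicInt.cast_toZModPow 1 (n + 1) (Nat.le_add_left 1 n), hσn,
    PadicInt.cast_toZModPow 1 (n + 1) (Nat.le_add_left 1 n), hu]

/-- **The cell maps of the relative tower over an unramified base feed `comap` unconditionally**:
de Shalit's (10) on `Γ_E` at `p = 2` for `E ≤ maxUnramified F` (`F ≅ ℚ_2`), for any bounded
distribution `ν` on `ℤ_2`, any cell maps `ψ` (`exists_ltRelCellMap`) and any uniformly continuous `g`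
(the normality instance is `fun n ↦ ltRelTower_U_normal hπ E n`, supply it with `haveI`).
[cite: deShalit1987, I.3.4 (10) (p. 18), I.1.8 (p. 13)] -/
theorem integral_comap_restrictUnits_ltRelTower_of_le_maxUnramified [FiniteDimensional F E]
    (hπ₂ : (valuation F).IsUniformizer (π : F)) (e₂ : 𝒪[F] ≃+* ℤ_[2])
    [∀ n, ((ltRelTower hπ₂ E).U n).Normal] (hE : E ≤ maxUnramified F)
    {𝕜 : Type*} [NormedField 𝕜] [IsUltrametricDist 𝕜] [CompleteSpace 𝕜]
    (ν : BoundedDistribution (ProfiniteTower.padicInt 2) 𝕜)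
    (ψ : (n : ℕ) → ↥(E.fixingSubgroup.comap (Field.absoluteGaloisGroup.toAlgEquiv F).toMonoidHom) ⧸
      (ltRelTower hπ₂ E).U n → ZMod (2 ^ (n + 1)))
    (hψ : ∀ (n : ℕ) (σ : ↥(E.fixingSubgroup.comap (Field.absoluteGaloisGroup.toAlgEquiv F).toMonoidHom)),
      σ ∈ (ltRelTower hπ₂ E).U 0 →
        ψ n ((ltRelTower hπ₂ E).proj n σ) = PadicInt.toZModPow (n + 1)
          ((((Units.map (e₂ : 𝒪[F] →+* ℤ_[2]).toMonoidHom).comp (lubinTateCharHom hπ₂)).comp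
            (E.fixingSubgroup.comap (Field.absoluteGaloisGroup.toAlgEquiv F).toMonoidHom).subtype σ :
              ℤ_[2]ˣ) : ℤ_[2]))
    {g : ℤ_[2] → 𝕜} (hg : UniformContinuous g) :
    (GroupDistribution.comap (restrictUnits ν) ψ
        ((ltRelTower hπ₂ E).cellMap_trans _ ψ hψ)
        ((ltRelTower hπ₂ E).cellMap_injective _ (mem_ltRelTower_iff hπ₂ E e₂) ψ hψ)
        ((ltRelTower hπ₂ E).cellMap_fiberSurj _ (mem_ltRelTower_iff hπ₂ E e₂)
          (exists_toZModPow_ltRelCharacter_eq_of_le_maxUnramified hπ₂ E e₂ hE) ψ hψ)).integral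
        (fun σ ↦ (if (ltRelTower hπ₂ E).proj 0 σ = 1 then (1 : 𝕜) else 0) *
          g (((((Units.map (e₂ : 𝒪[F] →+* ℤ_[2]).toMonoidHom).comp (lubinTateCharHom hπ₂)).comp
            (E.fixingSubgroup.comap (Field.absoluteGaloisGroup.toAlgEquiv F).toMonoidHom).subtype σ :
              ℤ_[2]ˣ) : ℤ_[2]))) =
      (restrictUnits ν).integral g :=
  GroupDistribution.integral_comap_restrictUnits_of_character_two _ ν (mem_ltRelTower_iff hπ₂ E e₂)
    (exists_toZModPow_ltRelCharacter_eq_of_le_maxUnramified hπ₂ E e₂ hE) ψ hψ hg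

end Unramified

end Literature.NumberTheory.GaloisRepresentations

end
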